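import Summits.ResolutionOfSingularities.ResolutionOfSingularities.Theorems.UniformComplexityPrimeModelTransferOfFamilyResolutionOneFibre
import HarnessLib

/-!
# Crux `PrimeModelTransfer` (stmt-ResolutionOfSingularities-8933), door 2 of slot W8.2:
# one smooth closed fibre suffices — the E7 theorem with the datum asked only over the
# finitely generated `k`-SUBALGEBRAS of the target field

Route `ResolutionOfSingularities/UniformComplexity`. The E7 theorem
`PrimeModelTransfer.hasResolution_of_familyResolutionOneFibre` (p542421) assumes the one-closed-fibre datum
(`CampaignW82.FamilyResolutionOneFibre k`, p540376) for proper families over ALL finitely generated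
`k`-domains, but its proof uses it for ONE: the finitely generated `k`-subalgebra `R ⊆ K` over which the
given `K`-variety spreads out. THIS FILE records that sharper form, needed for the PENCIL normal form
(`CampaignW82.PencilResolutionOneFibre`, p546090: bases of transcendence degree `≤ 1`), where the target
`K` has transcendence degree `≤ 1` over `k` and hence so do all its finitely generated `k`-subalgebras:

* `exists_isPullback_proper_subalgebra_algHom` — gen 5's `exists_isPullback_proper_subalgebra` (p528212)
  with the `K`-point returned as a `k`-ALGEBRA map `ψ : R →ₐ[k] K` (same proof; the witness was already the
  inclusion of a `k`-subalgebra);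
* `hasResolution_of_forall_subalgebra_oneFibre` — **if every finitely generated `k`-domain `A` with an
  injective `k`-algebra map `A → K` has the one-closed-fibre property for its proper families with integral
  geometric generic fibre, then every integral separated `K`-scheme of finite type has a resolution**
  (`K` algebraically closed; proof = that of p542421 verbatim, with the hypothesis invoked at `(R, ψ)`).

[OURS · LADDER-RESOLUTION L1, slot W8.2 (prime-field / universality transfer), door 2
UniformComplexity] Theorems over the summit's own route and OURS names; NOT statements of, and
attributing nothing to, Hironaka's 2017 manuscript. AI-written; weaker than expert review. Barrier
bookkeeping: as in p542421 (no base change of a regular scheme along an inseparable extension; smoothness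
of the `K`-fibre from ONE smooth closed fibre via EGA IV₃ 12.2.4 (iii)).

Sources: A. Grothendieck, J. Dieudonné, EGA IV₃ (1966) Thm. 12.2.4 (iii), Thm. 8.8.2 (ii); EGA IV₄
(1967) Thm. 17.5.1; U. Görtz, T. Wedhorn, *Algebraic Geometry I* (2nd ed. 2020) Prop. 10.75 (1); The
Stacks Project, Tags 01V8, 01ZM, 09GU. [cite: EGAIV3, Thm. 12.2.4 (iii)] [cite: EGAIV3, Thm. 8.8.2 (ii)]
[cite: StacksProject, Tag 01V8]
-/

noncomputable section

set_option linter.dupNamespace false -- mandated namespace of this single-conjunct summit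

open CategoryTheory CategoryTheory.Limits AlgebraicGeometry TopologicalSpace
open Literature.AlgebraicGeometry.Resolution

namespace Summit.ResolutionOfSingularities.ResolutionOfSingularities.Theorems.PrimeModelTransfer

open MonoidalCategory CartesianMonoidalCategory
open Literature.AlgebraicGeometry.Limits
open Literature.AlgebraicGeometry.Motives (SchemeOver specOver projectiveSpace)

set_option backward.isDefEq.respectTransparency false

/-! ## A projective `K`-variety as the fibre of a proper family at a `k`-algebra point -/

/-- **Proper model over a finitely generated subalgebra, `k`-algebra point.** As gen 5's
`exists_isPullback_proper_subalgebra` (p528212): for fields `k ⊆ K` and `g : Y → Spec K` projective there are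
a finite-type `k`-domain `R`, an INJECTIVE `k`-ALGEBRA map `ψ : R → K`, a PROPER `F : X' → Spec R` and
`π : Y → X'` with `(π, g; F, Spec ψ)` cartesian — `Y = X' ×_{Spec R} Spec K`. Same proof (`ℙⁿ_K = lim_t ℙⁿ_k
×_k Spec k[t]`, `SubalgApprox.isLimitProdCone`; the closed subscheme descends to a finite stage,
`exists_isPullback_toImage_of_isLocallyNoetherian`); only the packaging of `ψ` (the inclusion of the
`k`-subalgebra `k[t] ⊆ K`) as an `AlgHom` is new. [cite: GortzWedhorn2020, Prop. 10.75 (1) and (10.13)]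
[cite: EGAIV3, Thm. 8.8.2 (ii)] -/
theorem exists_isPullback_proper_subalgebra_algHom (k K : Type) [Field k] [Field K] [Algebra k K]
    {Y : Scheme.{0}} (g : Y ⟶ Spec (.of K))
    (hproj : ChowLemmaRing.IsProjOver (Over.mk g : SchemeOver K)) :
    ∃ (R : Type) (_ : CommRing R) (_ : IsDomain R) (_ : Algebra k R) (ψ : R →ₐ[k] K)
      (X' : Scheme.{0}) (F : X' ⟶ Spec (.of R)) (π : Y ⟶ X'),
      Function.Injective ψ ∧ Algebra.FiniteType k R ∧ IsProper F ∧
        IsPullback π g F (Spec.map (CommRingCat.ofHom ψ.toRingHom)) := by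
  classical
  obtain ⟨n, ι, hι⟩ := hproj
  haveI := hι
  -- `ℙⁿ_K ≅ Spec K ×_k ℙⁿ_k`
  obtain ⟨eK, heK⟩ := exists_iso_projectiveSpace_pullback k n K
  let P : SchemeOver k := projectiveSpace n k
  haveI : IsProper P.hom := Literature.AlgebraicGeometry.Motives.isProper_projectiveSpace n k
  haveI : QuasiCompact P.hom := inferInstance
  haveI : IsSeparated P.hom := inferInstance
  haveI : LocallyOfFiniteType P.hom := inferInstance
  haveI : QuasiSeparated P.hom := inferInstance
  -- the limit presentation `ℙⁿ_k ×_k Spec K = lim_t ℙⁿ_k ×_k Spec k[t]`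
  let D := SubalgApprox.prodDiagram k K (∅ : Finset K) P
  let c := SubalgApprox.prodCone k K (∅ : Finset K) P
  have hc : IsLimit c := SubalgApprox.isLimitProdCone k K ∅ P
  have hpt : c.pt = pullback P.hom (Spec.map (CommRingCat.ofHom (algebraMap k K))) := rfl
  -- the closed immersion `j : Y ↪ ℙⁿ_k ×_k Spec K` over `Spec K`
  let j : Y ⟶ c.pt :=
    ι.left ≫ eK.hom ≫ (pullbackSymmetry (Spec.map (CommRingCat.ofHom (algebraMap k K))) P.hom).hom
  haveI : IsClosedImmersion j := by
    change IsClosedImmersion (ι.left ≫ eK.hom ≫ (pullbackSymmetry _ _).hom)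
    infer_instance
  have hjg : j ≫ pullback.snd P.hom (specOver k K).hom = g := by
    have e1 : (pullbackSymmetry (Spec.map (CommRingCat.ofHom (algebraMap k K))) P.hom).hom ≫
        pullback.snd P.hom (Spec.map (CommRingCat.ofHom (algebraMap k K))) =
          pullback.fst (Spec.map (CommRingCat.ofHom (algebraMap k K))) P.hom :=
      pullbackSymmetry_hom_comp_snd _ _
    have e2 : ι.left ≫ (projectiveSpace n K).hom = g := Over.w ι
    calc j ≫ pullback.snd P.hom (specOver k K).hom
        = ι.left ≫ eK.hom ≫ ((pullbackSymmetry (Spec.map (CommRingCat.ofHom (algebraMap k K)))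
            P.hom).hom ≫ pullback.snd P.hom (Spec.map (CommRingCat.ofHom (algebraMap k K)))) := by
          simp only [j, Category.assoc]; rfl
      _ = ι.left ≫ (eK.hom ≫ pullback.fst (Spec.map (CommRingCat.ofHom (algebraMap k K))) P.hom) := by
          rw [e1]
      _ = g := by rw [heK]; exact e2
  -- the limit is locally Noetherian: of finite type over the field `K`
  haveI : IsLocallyNoetherian c.pt := by
    rw [hpt]
    exact LocallyOfFiniteType.isLocallyNoetherian
      (pullback.snd P.hom (Spec.map (CommRingCat.ofHom (algebraMap k K))))
  -- the closed subscheme `Y` comes from a finite stage `t`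
  obtain ⟨t, ht⟩ := exists_isPullback_toImage_of_isLocallyNoetherian D c hc j
  have hsq := ht t (𝟙 t)
  let R : Subalgebra k K := SubalgApprox.sub k K t.unop.1
  let πt : c.pt ⟶ D.obj t := c.π.app t
  let X' : Scheme.{0} := (j ≫ πt).image
  let ι' : X' ⟶ D.obj t := (j ≫ πt).imageι
  let q : D.obj t ⟶ Spec (.of R) := pullback.snd P.hom ((SubalgApprox.baseDiagram k K ∅).obj t).hom
  haveI : IsProper q := inferInstanceAs (IsProper (pullback.snd P.hom _))
  haveI : IsClosedImmersion ι' := inferInstanceAs (IsClosedImmersion (j ≫ πt).imageι)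
  refine ⟨R, inferInstance, inferInstance, inferInstance, R.val, X', ι' ≫ q, (j ≫ πt).toImage,
    fun x y h ↦ Subtype.ext h, SubalgApprox.finiteType_sub k K t.unop.1, inferInstance, ?_⟩
  -- paste the image square with the base-change square over `Spec K → Spec k[t]`
  have h2 : IsPullback πt (pullback.snd P.hom (specOver k K).hom) q
      ((SubalgApprox.baseCone k K ∅).π.app t).left :=
    SubalgApprox.isPullback_whiskerLeft_left P ((SubalgApprox.baseCone k K ∅).π.app t)
  have h12 := hsq.flip.paste_vert h2
  rw [hjg] at h12
  exact h12


/-! ## ONE SMOOTH CLOSED FIBRE over the subalgebras of `K` ⇒ resolution over `K` -/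

/-- **One-closed-fibre data over the finitely generated `k`-subalgebras of `K` give resolution over the
algebraically closed `K`.** Let `k ⊆ K` be fields with `K` algebraically closed. Assume that for every
finitely generated `k`-domain `A` with an injective `k`-algebra map `A → K` and every proper
`f : 𝒳 → Spec A` with integral geometric generic fibre, the one-closed-fibre datum of
`CampaignW82.FamilyResolutionOneFibre` exists (algebraic finite-type injective `A → A'`, proper
`G : 𝒴 → 𝒳 ×_A A'` an isomorphism over an open `W` meeting the fibre over a closed `s`, `𝒴 → Spec A'` flat
over `s` with smooth fibre). Then every integral separated `K`-scheme of finite type has a resolution.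
Proof: VERBATIM that of `hasResolution_of_familyResolutionOneFibre` (p542421) — Nagata + Chow; proper model
over `(R, ψ : R →ₐ[k] K)` (`exists_isPullback_proper_subalgebra_algHom`); integral geometric generic
fibre; the datum AT `(R, ψ)`; EGA IV₃ 12.2.4 (iii) (`Morphisms.exists_smooth_morphismRestrict_of_smooth_fiber`)
makes `𝒴 → Spec A'` smooth over an open `V ∋ s`; the `K`-point lifts injectively to `A'`
(`IsAlgClosed.lift`, `Ideal.comap_ne_bot_of_algebraic_mem`), i.e. into `V`; the `K`-fibre of `G` is proper
with smooth (regular) source and an isomorphism over the preimage of `W`, non-empty by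
`Flat.generalizingMap`; `hasResolution_of_isIso_morphismRestrict` (p483756).
[cite: EGAIV3, Thm. 12.2.4 (iii)] [cite: StacksProject, Tag 01ZM] -/
theorem hasResolution_of_forall_subalgebra_oneFibre (k K : Type) [Field k] [Field K] [IsAlgClosed K]
    [Algebra k K]
    (hOF : ∀ (A : Type) [CommRing A] [IsDomain A] [Algebra k A] (ψ : A →ₐ[k] K),
      Function.Injective ψ → Algebra.FiniteType k A →
      ∀ (𝒳 : Scheme.{0}) (f : 𝒳 ⟶ Spec (.of A)), IsProper f →
        IsIntegral (pullback f (Spec.map (CommRingCat.ofHom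
            (algebraMap A (AlgebraicClosure (FractionRing A)))))) →
        ∃ (A' : Type) (_ : CommRing A') (_ : IsDomain A') (_ : Algebra A A'),
          Function.Injective (algebraMap A A') ∧ Algebra.FiniteType A A' ∧ Algebra.IsAlgebraic A A' ∧
          ∃ (𝒴 : Scheme.{0})
            (G : 𝒴 ⟶ pullback f (Spec.map (CommRingCat.ofHom (algebraMap A A'))))
            (W : (pullback f (Spec.map (CommRingCat.ofHom (algebraMap A A')))).Opens)
            (s : ↥(Spec (.of A'))),
            IsClosed ({s} : Set ↥(Spec (.of A'))) ∧
            IsProper G ∧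
            IsIso (G ∣_ W) ∧
            (∃ x : ↥(pullback f (Spec.map (CommRingCat.ofHom (algebraMap A A')))),
              x ∈ W ∧ (pullback.snd f (Spec.map (CommRingCat.ofHom (algebraMap A A')))) x = s) ∧
            (∀ y : ↥𝒴, (G ≫ pullback.snd f (Spec.map (CommRingCat.ofHom (algebraMap A A')))) y = s →
              ((G ≫ pullback.snd f (Spec.map (CommRingCat.ofHom (algebraMap A A')))).stalkMap y).hom.Flat) ∧
            Smooth ((G ≫ pullback.snd f
              (Spec.map (CommRingCat.ofHom (algebraMap A A')))).fiberToSpecResidueField s))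
    (X : Scheme.{0}) (f : X ⟶ Spec (.of K)) [IsSeparated f] [LocallyOfFiniteType f]
    [QuasiCompact f] [IsIntegral X] : Scheme.HasResolution X := by
  classical
  -- ### Step 0: it suffices to resolve integral PROJECTIVE `K`-schemes (Nagata + Chow)
  refine hasResolution_of_forall_proper K (fun Y₀ g₀ hg₀ hY₀ => ?_) X f
  haveI := hg₀
  haveI := hY₀
  obtain ⟨n, Y, ρ, ι, hY, hι, hρ, -, hw, U, hUd, hUpre, hUiso⟩ :=
    ChowLemmaRing.chow_proper (R := K) Y₀ g₀
  haveI := hρ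
  haveI := hι
  haveI := hY
  let g : Y ⟶ Spec (.of K) := ρ ≫ g₀
  have hproj : ChowLemmaRing.IsProjOver (Over.mk g : SchemeOver K) := ⟨n, Over.homMk ι hw, hι⟩
  refine Scheme.HasResolution.of_isBirational ρ ⟨U, hUd, hUpre, hUiso⟩ ?_
  -- ### Step 1: a proper model `F : X' → Spec R` over a finitely generated `k`-subalgebra `R ⊆ K`
  obtain ⟨R, _, _, _, ψa, X', F, π, hψ, hRft, hF, hsq⟩ :=
    exists_isPullback_proper_subalgebra_algHom k K g hproj
  let ψ : R →+* K := ψa.toRingHom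
  change Function.Injective ψ at hψ
  change IsPullback π g F (Spec.map (CommRingCat.ofHom ψ)) at hsq
  haveI := hRft
  haveI := hF
  letI : Algebra R K := ψ.toAlgebra
  haveI : FaithfulSMul R K := (faithfulSMul_iff_algebraMap_injective R K).mpr hψ
  -- ### Step 2: the geometric generic fibre `X' ×_R Spec (Frac R)^alg` is integral
  let L : Type := AlgebraicClosure (FractionRing R)
  haveI : Algebra.IsAlgebraic R (FractionRing R) :=
    IsLocalization.isAlgebraic (FractionRing R) (nonZeroDivisors R)
  haveI : Algebra.IsAlgebraic R L := Algebra.IsAlgebraic.trans R (FractionRing R) L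
  haveI : FaithfulSMul R L := (faithfulSMul_iff_algebraMap_injective R L).mpr (by
    rw [IsScalarTower.algebraMap_eq R (FractionRing R) L]
    exact (algebraMap (FractionRing R) L).injective.comp (IsFractionRing.injective R (FractionRing R)))
  let σ : L →ₐ[R] K := IsAlgClosed.lift
  have hσ : σ.toRingHom.comp (algebraMap R L) = ψ := σ.comp_algebraMap
  let iL : Spec (.of L) ⟶ Spec (.of R) := Spec.map (CommRingCat.ofHom (algebraMap R L))
  let jσ : Spec (.of K) ⟶ Spec (.of L) := Spec.map (CommRingCat.ofHom σ.toRingHom)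
  have hjσ : jσ ≫ iL = Spec.map (CommRingCat.ofHom ψ) := by
    change Spec.map _ ≫ Spec.map _ = _
    rw [← Spec.map_comp, ← CommRingCat.ofHom_comp, hσ]
  let XL : Scheme.{0} := pullback F iL
  let FL : XL ⟶ Spec (.of L) := pullback.snd F iL
  let m : Y ⟶ XL := pullback.lift π (g ≫ jσ) (by rw [Category.assoc, hjσ]; exact hsq.w)
  have hsqm : IsPullback m g FL jσ := by
    have outer : IsPullback (m ≫ pullback.fst F iL) g F (jσ ≫ iL) := by
      rw [pullback.lift_fst, hjσ]; exact hsq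
    exact outer.of_right (pullback.lift_snd _ _ _) (IsPullback.of_hasPullback F iL)
  haveI : Subsingleton ↥(Spec (CommRingCat.of L)) := inferInstanceAs (Subsingleton (PrimeSpectrum L))
  haveI : Subsingleton ↥(Spec (CommRingCat.of K)) := inferInstanceAs (Subsingleton (PrimeSpectrum K))
  haveI : Nonempty ↥(Spec (CommRingCat.of K)) := inferInstanceAs (Nonempty (PrimeSpectrum K))
  haveI : Flat jσ := by
    letI : Algebra L K := σ.toRingHom.toAlgebra
    haveI hflat : Module.Flat L K := inferInstance
    rw [show jσ = Spec.map (CommRingCat.ofHom (algebraMap L K)) from rfl, Flat.SpecMap_iff,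
      CommRingCat.hom_ofHom]
    exact RingHom.flat_algebraMap_iff.mpr hflat
  haveI : Surjective jσ := inferInstance
  haveI : Flat m := MorphismProperty.of_isPullback (P := @Flat) hsqm.flip ‹Flat jσ›
  haveI : Surjective m := MorphismProperty.of_isPullback (P := @Surjective) hsqm.flip ‹Surjective jσ›
  haveI : IsReduced XL := Literature.AlgebraicGeometry.Morphisms.isReduced_of_flat_of_surjective m
  haveI : IrreducibleSpace XL := Function.Surjective.irreducibleSpace m.continuous m.surjective
  have hint : IsIntegral XL := isIntegral_of_irreducibleSpace_of_isReduced XL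
  -- ### Step 3: the one-closed-fibre datum over an algebraic finite-type extension `A'`
  obtain ⟨A', _, _, _, hinj, hA'ft, halg, 𝒴, G, W, s, -, hGp, hWiso, ⟨x, hxW, hxs⟩, hflat, hsm⟩ :=
    hOF R ψa hψ hRft X' F hF hint
  haveI := hGp
  haveI := hWiso
  haveI := hA'ft
  haveI : IsNoetherianRing R := Algebra.FiniteType.isNoetherianRing k R
  haveI : IsNoetherianRing A' := Algebra.FiniteType.isNoetherianRing R A'
  let ιA : Spec (.of A') ⟶ Spec (.of R) := Spec.map (CommRingCat.ofHom (algebraMap R A'))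
  let F' : pullback F ιA ⟶ Spec (.of A') := pullback.snd F ιA
  let q : 𝒴 ⟶ Spec (.of A') := G ≫ F'
  haveI : IsProper F' := inferInstance
  haveI : IsSeparated F' := inferInstance
  haveI : IsProper q := inferInstance
  haveI : LocallyOfFinitePresentation q := by
    rw [HasRingHomProperty.iff_appLE (P := @LocallyOfFinitePresentation)]
    intro U V e
    haveI := IsLocallyNoetherian.component_noetherian (X := Spec (.of A')) U
    exact RingHom.FinitePresentation.of_finiteType.mp
      (HasRingHomProperty.appLE @LocallyOfFiniteType q inferInstance U V e)
  -- ### Step 4 (EGA IV₃ 12.2.4 (iii)): `q` is smooth over an open `V ∋ s`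
  obtain ⟨V, hsV, hVsm⟩ :=
    Literature.AlgebraicGeometry.Morphisms.exists_smooth_morphismRestrict_of_smooth_fiber q hflat hsm
  haveI := hVsm
  -- ### Step 5: the `K`-point `R ⊆ K` lifts to an INJECTIVE `τ : A' → K`, i.e. to the generic point
  haveI : FaithfulSMul R A' := (faithfulSMul_iff_algebraMap_injective R A').mpr hinj
  let τ : A' →ₐ[R] K := IsAlgClosed.lift
  have hτ : τ.toRingHom.comp (algebraMap R A') = ψ := τ.comp_algebraMap
  have hτinj : Function.Injective τ.toRingHom := by
    rw [injective_iff_map_eq_zero]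
    intro a ha
    by_contra ha0
    have h1 : (RingHom.ker τ.toRingHom).comap (algebraMap R A') ≠ ⊥ :=
      Ideal.comap_ne_bot_of_algebraic_mem ha0 ((RingHom.mem_ker).mpr ha)
        (Algebra.IsAlgebraic.isAlgebraic a)
    apply h1
    rw [eq_bot_iff]
    intro r hr
    rw [Ideal.mem_comap, RingHom.mem_ker, ← RingHom.comp_apply, hτ] at hr
    exact (Ideal.mem_bot).mpr ((injective_iff_map_eq_zero ψ).mp hψ r hr)
  let cτ : Spec (.of K) ⟶ Spec (.of A') := Spec.map (CommRingCat.ofHom τ.toRingHom)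
  have hcτ : cτ ≫ ιA = Spec.map (CommRingCat.ofHom ψ) := by
    change Spec.map _ ≫ Spec.map _ = _
    rw [← Spec.map_comp, ← CommRingCat.ofHom_comp, hτ]
  -- the image of `Spec K` is the generic point: it generizes every point of `Spec A'`
  have hgen : ∀ (t : ↥(Spec (CommRingCat.of K))) (z : ↥(Spec (CommRingCat.of A'))), cτ t ⤳ z := by
    intro t z
    have hbot : (cτ t).asIdeal = ⊥ := by
      change Ideal.comap τ.toRingHom t.asIdeal = ⊥
      rw [Ideal.eq_bot_of_prime t.asIdeal]
      exact Ideal.comap_bot_of_injective _ hτinj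
    exact (PrimeSpectrum.le_iff_specializes _ _).mp
      ((PrimeSpectrum.asIdeal_le_asIdeal _ _).mp (by rw [hbot]; exact bot_le))
  have hcτV : Set.range cτ ⊆ (V : Set ↥(Spec (CommRingCat.of A'))) := by
    rintro _ ⟨t, rfl⟩
    exact (hgen t s).mem_open V.2 hsV
  -- ### Step 6: the `K`-fibre `G_K : 𝒴_K → (X' ×_R A') ×_{A'} K ≅ Y` is a weak resolution
  let Xτ : Scheme.{0} := pullback F' cτ
  let gτ : Xτ ⟶ pullback F ιA := pullback.fst F' cτ
  let pτ : Xτ ⟶ Spec (.of K) := pullback.snd F' cτ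
  let Gτ : pullback G gτ ⟶ Xτ := pullback.snd G gτ
  have HG : IsPullback (pullback.fst G gτ) Gτ G gτ := IsPullback.of_hasPullback G gτ
  have Hc : IsPullback gτ pτ F' cτ := IsPullback.of_hasPullback F' cτ
  have Hq : IsPullback (pullback.fst G gτ) (Gτ ≫ pτ) q cτ := HG.paste_vert Hc
  haveI : Smooth (Gτ ≫ pτ) := smooth_of_isPullback_of_range_subset V Hq hcτV
  haveI : IsProper (Gτ ≫ pτ) := MorphismProperty.of_isPullback (P := @IsProper) Hq inferInstance
  haveI : IsSeparated pτ := inferInstance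
  haveI : IsProper Gτ := IsProper.of_comp Gτ pτ
  have hreg : Scheme.IsRegular (pullback G gτ) := fun y =>
    isRegularLocalRing_stalk_of_smooth_of_field (Gτ ≫ pτ) y
  haveI : IsIso (Gτ ∣_ (gτ ⁻¹ᵁ W)) :=
    Literature.AlgebraicGeometry.Morphisms.isIso_morphismRestrict_pullback_snd G gτ W
  -- a point of `G⁻¹(W)` over `s` …
  let y₀' : ↥(G ⁻¹ᵁ W) := inv (G ∣_ W) ⟨x, hxW⟩
  let y₀ : ↥𝒴 := (G ⁻¹ᵁ W).ι y₀'
  have hy₀W : y₀ ∈ G ⁻¹ᵁ W := by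
    change (G ⁻¹ᵁ W).ι y₀' ∈ G ⁻¹ᵁ W
    rw [show ((G ⁻¹ᵁ W).ι y₀' : ↥𝒴) = (y₀' : ↥𝒴) from rfl]
    exact y₀'.2
  have hGy₀ : G y₀ = x := by
    change ((G ⁻¹ᵁ W).ι ≫ G) y₀' = x
    rw [← morphismRestrict_ι, Scheme.Hom.comp_apply]
    change ((W.ι) ((inv (G ∣_ W) ≫ (G ∣_ W)) ⟨x, hxW⟩)) = x
    rw [IsIso.inv_hom_id]
    rfl
  have hqy₀ : q y₀ = s := by
    change F' (G y₀) = s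
    rw [hGy₀]; exact hxs
  -- … generizes, along the flat `q|_V`, to a point of `G⁻¹(W)` over the generic point
  haveI : Nonempty ↥(Spec (CommRingCat.of K)) := inferInstanceAs (Nonempty (PrimeSpectrum K))
  let pt : ↥(Spec (CommRingCat.of K)) := Nonempty.some inferInstance
  have hy₀V : y₀ ∈ q ⁻¹ᵁ V := by
    change q y₀ ∈ V
    rw [hqy₀]; exact hsV
  let a : ↥(q ⁻¹ᵁ V) := ⟨y₀, hy₀V⟩
  let b : ↥V := ⟨cτ pt, hcτV ⟨pt, rfl⟩⟩
  have hab : b ⤳ (q ∣_ V) a := by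
    rw [← (V.ι).isOpenEmbedding.isEmbedding.isInducing.specializes_iff]
    have h1 : (V.ι) ((q ∣_ V) a) = q y₀ := by
      rw [← Scheme.Hom.comp_apply, morphismRestrict_ι, Scheme.Hom.comp_apply]
      rfl
    rw [h1, hqy₀]
    exact hgen pt s
  obtain ⟨a', ha'a, ha'b⟩ := Flat.generalizingMap (q ∣_ V) hab
  let y₁ : ↥𝒴 := (q ⁻¹ᵁ V).ι a'
  have hy₁y₀ : y₁ ⤳ y₀ := ha'a.map (q ⁻¹ᵁ V).ι.continuous
  have hy₁W : y₁ ∈ G ⁻¹ᵁ W := hy₁y₀.mem_open (G ⁻¹ᵁ W).2 hy₀W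
  have hqy₁ : q y₁ = cτ pt := by
    change ((q ⁻¹ᵁ V).ι ≫ q) a' = cτ pt
    rw [← morphismRestrict_ι, Scheme.Hom.comp_apply, ha'b]
    rfl
  -- hence the preimage of `W` in the `K`-fibre is non-empty
  have hw : F' (G y₁) = cτ pt := by rw [← Scheme.Hom.comp_apply]; exact hqy₁
  obtain ⟨z, hz, -⟩ := Scheme.Pullback.exists_preimage_pullback (f := F') (g := cτ) (G y₁) pt hw
  have hne : ((gτ ⁻¹ᵁ W : Xτ.Opens) : Set ↥Xτ).Nonempty :=
    ⟨z, show gτ z ∈ W by rw [show gτ z = G y₁ from hz]; exact hy₁W⟩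
  -- ### Step 7: conclude on `(X' ×_R A') ×_{A'} K ≅ Y`
  let e : Xτ ≅ Y :=
    pullbackLeftPullbackSndIso F ιA cτ ≪≫ pullback.congrHom rfl hcτ ≪≫ hsq.isoPullback.symm
  haveI : IrreducibleSpace ↥Xτ :=
    Function.Surjective.irreducibleSpace e.inv.continuous e.inv.surjective
  haveI : IsProper pτ := inferInstance
  haveI : IsNoetherian (pullback G gτ) := isNoetherian_of_locallyOfFiniteType (Gτ ≫ pτ)
  exact Scheme.HasResolution.of_iso e.hom
    (hasResolution_of_isIso_morphismRestrict Gτ hreg (gτ ⁻¹ᵁ W) hne)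


end Summit.ResolutionOfSingularities.ResolutionOfSingularities.Theorems.PrimeModelTransfer

end
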